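import Literature.NumberTheory.EllipticCurves.PAdicLFunctionMultiplicativeInterpolation
import Literature.NumberTheory.EllipticCurves.SteinWuthrich2013.MultiplicativeLeadingTerm
import Literature.NumberTheory.EllipticCurves.BSDRootNumberSmallConductorProofs
import HarnessLib

/-!
# Disegni 2020, Theorem 4 (first clause) at a NON-SPLIT multiplicative prime: the rank-one `p`-adic
# Birch–Swinnerton-Dyer leading-term identity — `p`-adic versus complex leading term

Topic `Literature/NumberTheory/EllipticCurves` (cluster `Disegni2020`). ONE named fact (D-0014 style,
nothing asserted), no definition besides it, two proved API lemmas. HONEST FRAMING (BSD rank-`≤ 1`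
residual cell `b2b-bsdres`, lane CLASS-CLOSURE, seat `cc-typer-6`, class O9 = X2 ∩ {r = 1}): the cell
deletes the COMBINATION-SHAPED residual classes of the rank-`≤ 1` BSD formula STRICTLY from published
theorems and TYPES the remainder; this is not "finishing BSD". This file vendors ONE published theorem
that the cell's cyclotomic route at a multiplicative prime was missing at rank one: the analogue, at a
prime `p ‖ N` of NON-split multiplicative reduction, of Perrin-Riou's rank-one leading-term comparison
(`perrinRiou_rankOne_leadingTerms_odd`, good ordinary `p`). Consumers: the kernel exactness theorem
`Summit.….X2.certificate_iff_schneider_and_bsdp_of_mazurMainConjectureAt_nonsplit` (eisenstein-p2 gen 5),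
whose per-pair numerical certificate `hordL ∧ hcert` this fact supplies CLASS-WIDE modulo Schneider's
non-degeneracy; `Summits/…/X2/ClassClosureO9.lean` (this seat).

## The source, as printed (read 2026-08-21 on arXiv:1609.02528v3 = the accepted text; pages of the
materialised copy `paper:arxiv-1609.02528` in brackets)

D. Disegni, *On the `p`-adic Birch and Swinnerton-Dyer conjecture for elliptic curves over number
fields*, Kyoto J. Math. 60 (2020), no. 2, 473–510 [`Disegni2020`].

* Standing (p0003): "Fix a rational prime `p` and assume throughout this paper that `A/K` is an
  elliptic curve with ordinary (good or multiplicative) reduction at all primes `𝔭 ∣ p` of `K`."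
  Hypothesis (`L_p`) (p0003): a `p`-adic `L`-function `L_p^{(Γ)}(A) ∈ 𝒪_L⟦Γ⟧ ⊗ L` interpolating
  `∏_{𝔭∣p} e_𝔭(χ_𝔭) · L(A, χ, 1)/(|D_K|^{-1/2} Ω_A)` with `Ω_A` the Néron period and, for `χ_𝔭`
  unramified, `e_𝔭(χ_𝔭) = (1 − α_𝔭 χ(𝔭))(1 − α'_𝔭 χ(𝔭)⁻¹)`, where at a prime of multiplicative
  reduction `α_𝔭 = +1` (split) / `−1` (non-split) and `α'_𝔭 = 0`; so **`e_p(𝟙) = 2` at a non-split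
  multiplicative `p`**. Prop. 2.1 (p0009): for `E/ℚ`, `(E, Γ_ℚ)` satisfies (`L_p`) — "a theorem of
  Amice–Vélu and Vishik (see [MTT])", i.e. `L_p(E)` is THE Mazur–Tate–Teitelbaum function.
* Hypothesis (BSD_∞) (p0005): `r_an = rk A(K)` and
  `|Ш(A)|_an := L^{(r)}(A,1) / (r! |D_K|^{-1/2} R_NT(A) Ω_A ∏_v c_v(A)) ∈ ℚ^×`, where the Néron–Tate
  regulator `R_NT` "also accounts for `|A(K)_tors|²`" (Def. 2.2).
* **Statement (BSD_p)** (the paper's "Conjecture (BSD_p)", PROVED in the cases of Thm. 4; p0005): with `S_p^exc` the primes above `p` of SPLIT multiplicative reduction,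
  `r̃ := r + |S_p^exc|`, `ẽ_𝔭(𝟙) := e_𝔭(𝟙)` for `𝔭 ∉ S_p^exc`: "`L_p^{(Γ)}(A)` vanishes at `χ = 𝟙` to
  order at least `r̃` … and `d^{r̃} L_p^{(Γ)}(A, 𝟙) = ∏_{𝔭∣p} ẽ_𝔭(𝟙) · R̃_ℓ(A) · |Ш(A)|_an · ∏_v c_v(A)`
  in `Sym^{r̃} Γ ⊗ L`", `R̃_ℓ` the discriminant of the canonical (Nekovář) `p`-adic height `h_ℓ`
  (accounting for `|A(K)_tors|²`), which for `S_p^exc = ∅` "coincides" with the regulator of [MTT]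
  (§1.1.3 (b), p0004); "If [(BSD_p)] holds, the order of vanishing at `𝟙` … is `r̃` if and only if
  `R̃_ℓ(A) ≠ 0`". `d^{r̃}` is "the analogue of the Taylor coefficient `L^{(r̃)}/r̃!`" (p0004, footnote).
* **Theorem 4** (= Thm. 1.1 of the Introduction; §3.2, p0011): "Let `E/ℚ` be an elliptic curve with
  ordinary reduction at the prime `p`. Suppose that `r := ord_{s=1} L(E,s) ≤ 1`. Then: • If the
  reduction of `E` at `p` is not split multiplicative or `r = 0`, then [(BSD_p)] holds.
  • If `r = 1` and the reduction of `E` at `p` is split multiplicative, suppose that `p ≥ 5`. Then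
  [(BSD_p)] holds up to a nonzero rational number; if moreover there is at least another
  prime `m ≠ p` of multiplicative reduction for `E`, then [(BSD_p)] holds exactly."
  Proof of the first clause at `r = 1` (§3.2.1, p0012): the `p`-adic Gross–Zagier formula Thm. 2.4
  [= Disegni, Compositio 153 (2017) Thm. B, `Disegni2017`, whose hypotheses are "for all `v ∣ p`,
  `A/F_v` has potentially `𝔭`-ordinary good or SEMISTABLE reduction, `E_v/F_v` is split, and `χ` is
  not exceptional" — at `χ = 𝟙` a multiplicative prime is exceptional iff SPLIT] over an imaginary
  quadratic `K` with every prime of `N` split and `L(E^{(K)},1) ≠ 0`, Cor. 2.6 (Heegner index) and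
  Lemma 3.1 (invariance under `E ↦ E_K`); "This argument was of course already made by Perrin-Riou
  [PR] when `E` has good reduction."
* NO hypothesis on the residual representation `E[p]` anywhere in the statement or in §3.2.1 (the
  argument is automorphic: Heegner points, `p`-adic heights, `p`-adic Rankin–Selberg `L`-functions).
  The SPLIT clause is NOT vendored here: its proof (§3.2.2) imports Venerucci, Invent. Math. 203
  (2016) Thm. D, printed under the standing assumptions "`p > 3` … split multiplicative" and "`A_p` is
  an irreducible `𝔽_p[G_ℚ]`-module" (`Venerucci2015`, p. 2), which Disegni's statement does not repeat.

## The transcription (implied by, never stronger than, the source)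

For `E/ℚ` (globally minimal `W`), `p` odd of NON-split multiplicative reduction, `ord_{s=1} L(E,s) = 1`,
and THE data of the cell's multiplicative certificates (`Record.CertNonsplit`,
`X2.certificate_iff_schneider_and_bsdp_of_mazurMainConjectureAt_nonsplit`): the cyclotomic `(κ, γ)`
matching `T = γ − 1` (`IsCyclotomicVariable`), a newform `f` of `W`, the period ratio `ϖ ∈ ℚ` with
`ϖ · Ω(W) = Ω⁺_f`, THE non-split Mazur–Tate–Teitelbaum function `L` (`IsMultPAdicLFunctionOf f p (−1) L`,
interpolating with `Ω⁺_f`; `ϖ · L` interpolates with the Néron period as in (`L_p`)), the Tate parameter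
`q` of `E/ℚ_p` (`tateJ q = j(E)`), THE Stein–Wuthrich §4.2 height `Dh` (`IsMultCanonical Dh q`: at a
non-exceptional prime Nekovář's canonical height "is known to coincide with the norm-adapted height
pairings à la Schneider … and with the Mazur–Tate height pairings" — `Disegni2017` p. 7 —, which is
the height of Stein–Wuthrich 2013 §4.2 / Thm. 6.1, `SteinWuthrich2013`), and Miller's rational
`s = #Ш(E/ℚ)_an = L'(E,1)·#tors²/(Ω·Reg·∏c)` (`shaAn W = s`): the PROVED statement (BSD_p) for `(E, Γ_ℚ)` reads
`[T¹]L · log_p(γ_cyc) · ϖ = 2 · (Reg_p(E,Dh)/#tors²) · |Ш|_an · ∏c` up to the sign and power-of-`2`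
conventions of the height (Disegni §3.2.2 records such factors of `2` between normalisations), with
`L ∈ (T)`. RECORDED: (i) `1 ≤ ord_{T=0} L`; (ii) if `Reg_p(E,Dh) ≠ 0` then `ord_{T=0} L = 1` and the
identity IN VALUATIONS, `ord_p(ϖ·[T¹]L·log_p(γ_cyc)·#tors²) = ord_p(2·∏c·Reg_p(E,Dh)) + ord_p s` —
insensitive to signs and to powers of `2` at odd `p`; (ii) follows from the printed equality because
`s ≠ 0` (`L'(E,1) ≠ 0` at analytic rank one), `ϖ ≠ 0`, `log_p(γ_cyc) ≠ 0`. The prime is restricted to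
`p ≠ 2` (source: any prime of ordinary reduction) because the tree's cyclotomic normalisation
`γ_cyc = 1 + p` and the Stein–Wuthrich height are the odd-prime ones. Nothing about `E[p]` is assumed
— this is the point for the Eisenstein class X2 (`E[p]` reducible) as much as for X11b (irreducible).

## What this file provides

* `padicBSD_rankOne_nonsplitMult` (NAMED FACT, nothing asserted).
* `padicBSD_rankOne_nonsplitMult.order_eq_one`, `….valuation_eq` (proved projections).

References: [Disegni2020] Thm. 4 (§3.2), Conj. (BSD_p) (§1.1.4), Hyp. (L_p) (§1.1.1), Prop. 2.1,
Thm. 2.4, §3.2.1; [Disegni2017] Thm. B (§1.3); [MazurTateTeitelbaum1986Invent] §I.10–§I.14, §II.10;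
[SteinWuthrich2013] §4.2, Thm. 6.1; [PerrinRiou1987] §1.4 Cor. 1.8 (the good-reduction case);
[Venerucci2015] p. 2 (standing hypotheses of the split case, NOT vendored); [Miller2011LMS] Def. 1.1.
-/

noncomputable section

open scoped Classical MatrixGroups ModularForm

open CongruenceSubgroup WeierstrassCurve Literature.NumberTheory.EllipticCurves.ModularForms
  Literature.NumberTheory.EllipticCurves.SteinWuthrich2013

namespace Literature.NumberTheory.EllipticCurves.Disegni2020

/-! ### The named fact -/

/-- **Disegni 2020, Theorem 4, first clause, at analytic rank one and a NON-SPLIT multiplicative prime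
(the `p`-adic Birch–Swinnerton-Dyer leading-term identity, `p`-adic versus complex).** (D. Disegni,
Kyoto J. Math. 60 (2020), Thm. 4 = Thm. 1.1: "Let `E/ℚ` be an elliptic curve with ordinary reduction
at the prime `p`. Suppose that `r := ord_{s=1} L(E,s) ≤ 1`. If the reduction of `E` at `p` is not split
multiplicative or `r = 0`, then [statement (BSD_p) of §1.1.4] holds", where (BSD_p) for `(E, Γ_ℚ)` at a non-split
multiplicative `p` with `r = 1` says: `L_p(E)` vanishes at `𝟙` to order `≥ 1` and
`d¹L_p(E,𝟙) = e_p(𝟙) · R_ℓ(E) · |Ш(E)|_an · ∏_v c_v(E)`, `e_p(𝟙) = (1 − α_p)(1 − α'_p) = 2`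
(`α_p = −1`, `α'_p = 0`), `R_ℓ` the canonical `p`-adic regulator divided by `#E(ℚ)_tors²`,
`|Ш(E)|_an = L'(E,1)·#tors²/(Ω_E·Reg_NT·∏c)`; proof via the `p`-adic Gross–Zagier formula of
Disegni, Compositio 153 (2017) Thm. B at the non-exceptional prime `p`, "already made by Perrin-Riou
when `E` has good reduction". NO hypothesis on `E[p]`.) TRANSCRIPTION (tree normalisations of the
multiplicative certificates, see the module docstring; recorded in valuation form, which the printed
equality implies and which is insensitive to the sign / power-of-`2` conventions of the height): for
`W/ℚ` globally minimal elliptic, `p ≠ 2` of non-split multiplicative reduction, `ord_{s=1} L(E,s) = 1`,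
the cyclotomic `(κ, γ)` matching `T`, a newform `f` of `W`, `ϖ ∈ ℚ` with `ϖ·Ω(W) = Ω⁺_f`, THE
non-split Mazur–Tate–Teitelbaum function `L` of `f`, the Tate parameter `q` of `E/ℚ_p`, THE
Stein–Wuthrich §4.2 height `Dh`, and `s ∈ ℚ` with `#Ш(E/ℚ)_an = s`: (i) `1 ≤ ord_{T=0} L`; (ii) if
`Reg_p(E,Dh) ≠ 0` then `ord_{T=0} L = 1` and
`ord_p(ϖ·[T¹]L·log_p(γ_cyc)·#E(ℚ)_tors²) = ord_p(2·∏_ℓ c_ℓ·Reg_p(E,Dh)) + ord_p s`.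
Source range: every prime of ordinary reduction; here `p ≠ 2` (tree's odd-prime normalisations).
Named fact (D-0014): nothing is asserted; users take `(h : padicBSD_rankOne_nonsplitMult)`.
[cite: Disegni2020, Thm. 4 (§3.2) with Conj. (BSD_p) (§1.1.4), Hyp. (L_p) (§1.1.1), Prop. 2.1, §3.2.1]
[cite: Disegni2017, Thm. B (§1.3: "potentially 𝔭-ordinary good or semistable reduction … χ not exceptional")]
[cite: MazurTateTeitelbaum1986Invent, §I.14 and §II.10] [cite: SteinWuthrich2013, §4.2 and Thm. 6.1]
[cite: Miller2011LMS, Def. 1.1] -/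
def padicBSD_rankOne_nonsplitMult : Prop :=
  ∀ (W : WeierstrassCurve ℚ) [W.IsElliptic] [W.IsGloballyMinimal] (p : ℕ) [Fact p.Prime],
    p ≠ 2 → W.HasMultiplicativeReductionAtPrime p → ¬ W.HasSplitMultiplicativeReductionAtPrime p →
    W.analyticRank = 1 →
    ∀ (κ : ZpExtension ℚ p) (γ : Field.absoluteGaloisGroup ℚ),
      κ.IsCyclotomic → κ.IsTopGenerator γ → IsCyclotomicVariable p γ →
    ∀ ⦃N : ℕ⦄ [NeZero N] (f : CuspForm (Gamma0 N) 2), IsNewformOf W f →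
    ∀ (ϖ : ℚ), (ϖ : ℝ) * W.realPeriodRat = plusPeriod f →
    ∀ (L : PowerSeries ℚ_[p]), IsMultPAdicLFunctionOf f p (-1) L →
    ∀ (q : ℚ_[p]), q ≠ 0 → ‖q‖ < 1 → tateJ q = (W.j : ℚ_[p]) →
    ∀ (Dh : PAdicHeightData W p), IsMultCanonical Dh q →
    ∀ (s : ℚ), shaAn W = (s : ℂ) →
      1 ≤ L.order ∧
      (padicRegulator Dh ≠ 0 →
        L.order = ((1 : ℕ) : ℕ∞) ∧
        (((ϖ : ℚ) : ℚ_[p]) * PowerSeries.coeff 1 L *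
            (padicLog p (cyclotomicGenerator p) ^ 1 * (W.torsionOrder : ℚ_[p]) ^ 2)).valuation =
          (2 * (W.tamagawaProduct : ℚ_[p]) * padicRegulator Dh).valuation + padicValRat p s)

/-! ### Proved projections (API) -/

namespace padicBSD_rankOne_nonsplitMult

/-- Under Schneider's non-degeneracy of THE §4.2 height, the non-split Mazur–Tate–Teitelbaum function
of a rank-one curve has a SIMPLE zero at `T = 0` (projection of the fact).
[cite: Disegni2020, Thm. 4 with Conj. (BSD_p): "the order of vanishing … is r̃ if and only if R̃ ≠ 0"] -/
theorem order_eq_one (h : padicBSD_rankOne_nonsplitMult) (W : WeierstrassCurve ℚ) [W.IsElliptic] [W.IsGloballyMinimal] (p : ℕ)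
    [Fact p.Prime] (hp : p ≠ 2) (hm : W.HasMultiplicativeReductionAtPrime p)
    (hns : ¬ W.HasSplitMultiplicativeReductionAtPrime p) (hr : W.analyticRank = 1)
    {κ : ZpExtension ℚ p} {γ : Field.absoluteGaloisGroup ℚ} (hκ : κ.IsCyclotomic)
    (hγ : κ.IsTopGenerator γ) (hγ' : IsCyclotomicVariable p γ) {N : ℕ} [NeZero N]
    {f : CuspForm (Gamma0 N) 2} (hf : IsNewformOf W f) {ϖ : ℚ}
    (hϖ : (ϖ : ℝ) * W.realPeriodRat = plusPeriod f) {L : PowerSeries ℚ_[p]}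
    (hL : IsMultPAdicLFunctionOf f p (-1) L) {q : ℚ_[p]} (hq0 : q ≠ 0) (hq1 : ‖q‖ < 1)
    (hqj : tateJ q = (W.j : ℚ_[p])) {Dh : PAdicHeightData W p} (hDh : IsMultCanonical Dh q)
    {s : ℚ} (hs : shaAn W = (s : ℂ)) (hSch : SchneiderConjecture Dh) :
    L.order = ((1 : ℕ) : ℕ∞) :=
  ((h W p hp hm hns hr κ γ hκ hγ hγ' f hf ϖ hϖ L hL q hq0 hq1 hqj Dh hDh s hs).2 hSch).1

/-- Under Schneider's non-degeneracy of THE §4.2 height: the rank-one leading-term identity in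
valuations (projection of the fact). [cite: Disegni2020, Thm. 4 (§3.2) with Conj. (BSD_p) (§1.1.4)] -/
theorem valuation_eq (h : padicBSD_rankOne_nonsplitMult) (W : WeierstrassCurve ℚ) [W.IsElliptic] [W.IsGloballyMinimal] (p : ℕ)
    [Fact p.Prime] (hp : p ≠ 2) (hm : W.HasMultiplicativeReductionAtPrime p)
    (hns : ¬ W.HasSplitMultiplicativeReductionAtPrime p) (hr : W.analyticRank = 1)
    {κ : ZpExtension ℚ p} {γ : Field.absoluteGaloisGroup ℚ} (hκ : κ.IsCyclotomic)
    (hγ : κ.IsTopGenerator γ) (hγ' : IsCyclotomicVariable p γ) {N : ℕ} [NeZero N]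
    {f : CuspForm (Gamma0 N) 2} (hf : IsNewformOf W f) {ϖ : ℚ}
    (hϖ : (ϖ : ℝ) * W.realPeriodRat = plusPeriod f) {L : PowerSeries ℚ_[p]}
    (hL : IsMultPAdicLFunctionOf f p (-1) L) {q : ℚ_[p]} (hq0 : q ≠ 0) (hq1 : ‖q‖ < 1)
    (hqj : tateJ q = (W.j : ℚ_[p])) {Dh : PAdicHeightData W p} (hDh : IsMultCanonical Dh q)
    {s : ℚ} (hs : shaAn W = (s : ℂ)) (hSch : SchneiderConjecture Dh) :
    (((ϖ : ℚ) : ℚ_[p]) * PowerSeries.coeff 1 L *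
        (padicLog p (cyclotomicGenerator p) ^ 1 * (W.torsionOrder : ℚ_[p]) ^ 2)).valuation =
      (2 * (W.tamagawaProduct : ℚ_[p]) * padicRegulator Dh).valuation + padicValRat p s :=
  ((h W p hp hm hns hr κ γ hκ hγ hγ' f hf ϖ hϖ L hL q hq0 hq1 hqj Dh hDh s hs).2 hSch).2

end padicBSD_rankOne_nonsplitMult

end Literature.NumberTheory.EllipticCurves.Disegni2020

end
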